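import Summits.PneNP.PneNP.Theorems.Capture.Negative.GateLocality
import Literature.Computability.Complexity.CircuitComposition

/-!
# `Capture` (stmt-PneNP-2659, route PneNP/ConvexRankGates) — negative-side lemmas: the PERM door revisited

Standing-adversary (cdisprove, gen 3 / cycle 3) output for the crux
`Summit.PneNP.PneNP.Theses.ConvexRankGates.Capture`, continuing `GateLocality.lean` (§1 there: the ORDER
obstruction `no_zmod_primePow_embedding` — `ℤ/p^k ↪̸ Sym(d)` for `d < p^k`, the backbone of the third-door
objection "LIN-UNSAT over `ℤ/2^{n^ε}` is not ONE PERM gate of polynomial width"). This file shows what that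
obstruction is worth and puts the PERM door in the normal form the line `csp-spine-meet-to-join` works in:

* `thr_six_two_isPermGate` — **the order obstruction is NOT a one-gate lower bound.** `Th₂⁶` (= LIN-UNSAT
  over `ℤ/P` in ONE unknown with the six equations `y = 0, …, y = 5`, for every prime `P ≥ 7`: unsolvable
  iff two distinct equations are selected) is ONE PERM gate on `5` points: wire `i` switches on a 5-cycle of
  the `i`-th Sylow 5-subgroup of `A₅`, the target is a 3-cycle; one Sylow subgroup has order `5`, two
  distinct ones generate `A₅` (explicit words, `wordProd_pairWord`). PERM gates compute by PAIRWISE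
  GENERATION, not through homomorphic images of the modelled group (`M₆ ↪ Sub(Sym 5)`; pairwise generating
  families of `Sym(d)` have size exponential in `d`, so `Th₂ⁿ ∈ PERM_{O(log n)}`).
* `IsBlockPermGate`, `IsPermGate.isBlockPermGate`, `IsBlockPermGate.exists_size_one` — BLOCK NORMAL FORM:
  a gate `v ↦ [τ ∈ ⨆_{vᵢ = 1} Pᵢ]` with a whole subgroup (several generators) per wire is a size-ONE circuit
  whose gate is an honest `PERM_s` gate reading wires repeatedly. The PERM door is thus a join-homomorphism
  `(2^{[n]}, ∪) → Sub(Sym d)` followed by the principal filter of `τ` (tool for the abelian coset stub: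
  annihilator blocks per constraint are free).
* `IsBlockPermGate.two_pow_chain_le` — the MYHILL–NERODE CHAIN INVARIANT: nested selections
  `S₀ ⊆ ⋯ ⊆ S_L` with consecutive residuals `T ↦ g(Sᵢ ∪ T)` distinct force a strict chain of joins, so
  `2^L ≤ s!` (generalises `perm_local`). For LIN-UNSAT over `ℤ/2^k` in `D` unknowns residual chains have
  length `≤ k(D+1)`: neither element orders nor chains can give a super-polynomial ONE-gate lower bound for the
  third door; that would need a lattice-embedding (coordinatisation-type) obstruction for the submodule
  lattice of `(ℤ/2^k)^3` inside `Sub(Sym d)`, which is not in print.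

Refuter seat cdisprove-stmt-PneNP-2659-g3, 2026-08-16. Crux work file: `Cruxes/Capture/Disproof.lean` §14.
-/

set_option linter.dupNamespace false -- `Summit.PneNP.PneNP.…`: summit = sub-problem (D-0017)

namespace Summit.PneNP.PneNP.Theorems.Capture.Negative

open Literature.Computability.Complexity Finset

section PermThreshold

open Equiv

/-- The 5-cycle `0 ↦ 1 ↦ a ↦ b ↦ c ↦ 0` of `Fin 5`. [folklore] -/
def cyc5 (a b c : Fin 5) : Perm (Fin 5) := swap 0 1 * swap 1 a * swap a b * swap b c

/-- One 5-cycle out of each of the six Sylow 5-subgroups of `A₅` (the six orderings of `{2,3,4}`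
after `0 ↦ 1`). [folklore] -/
def sylow5 : Fin 6 → Perm (Fin 5) :=
  ![cyc5 2 3 4, cyc5 2 4 3, cyc5 3 2 4, cyc5 3 4 2, cyc5 4 2 3, cyc5 4 3 2]

/-- The target 3-cycle `(0 1 2)`. [folklore] -/
def tau3 : Perm (Fin 5) := swap 0 1 * swap 1 2

/-- The product of a word in two letters `a` (`true`) and `b` (`false`). [folklore] -/
def wordProd {G : Type*} [Monoid G] (a b : G) : List Bool → G
  | [] => 1
  | c :: w => (if c then a else b) * wordProd a b w

/-- A word in `a, b` lies in the subgroup they generate. [folklore] -/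
theorem wordProd_mem_closure {G : Type*} [Group G] (a b : G) :
    ∀ w : List Bool, wordProd a b w ∈ Subgroup.closure ({a, b} : Set G)
  | [] => Subgroup.one_mem _
  | c :: w => by
    refine Subgroup.mul_mem _ ?_ (wordProd_mem_closure a b w)
    cases c
    · exact Subgroup.subset_closure (Set.mem_insert_of_mem _ (Set.mem_singleton _))
    · exact Subgroup.subset_closure (Set.mem_insert _ _)

/-- Words expressing `(0 1 2)` in each ordered pair of distinct Sylow representatives (breadth-first
search, lengths `≤ 7`; row `i`, column `j` is a word in `a = sylow5 i`, `b = sylow5 j`). [folklore] -/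
def pairWord : Fin 6 → Fin 6 → List Bool :=
  ![![[], [true, true, false, true, true], [true, true, true, false, true], [false, false, true, true],
      [false, false, false, true, false], [true, false, true, false]],
    ![[true, true, false, true, true], [], [false, false, false, true, false], [true, false, true, false],
      [true, true, true, false, true], [false, false, true, true]],
    ![[false, false, false, true, false], [true, true, true, false, true], [],
      [false, true, false, false, false], [true, true, false, false, false, true, true],
      [true, false, true, true, true]],
    ![[true, true, false, false], [false, true, false, true], [true, false, true, true, true], [],
      [false, true, false, false, false], [true, true, false, true, true]],
    ![[true, true, true, false, true], [false, false, false, true, false],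
      [true, true, false, false, false, true, true], [true, false, true, true, true], [],
      [false, true, false, false, false]],
    ![[false, true, false, true], [true, true, false, false], [false, true, false, false, false],
      [true, true, false, true, true], [true, false, true, true, true], []]]

set_option maxRecDepth 100000 in
/-- Every two distinct Sylow representatives generate the 3-cycle `(0 1 2)` (in fact all of `A₅`:
two distinct Sylow 5-subgroups lie in no common maximal subgroup `A₄`, `D₁₀`, `S₃`). [folklore] -/
theorem wordProd_pairWord : ∀ i j : Fin 6, i ≠ j →
    wordProd (sylow5 i) (sylow5 j) (pairWord i j) = tau3 := by
  intro i j h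
  fin_cases i <;> fin_cases j <;> first | exact absurd rfl h | decide

/-- The representatives have order `5`. [folklore] -/
theorem sylow5_pow_five : ∀ i : Fin 6, sylow5 i ^ 5 = 1 := by decide

/-- … and none of their powers is the 3-cycle. [folklore] -/
theorem sylow5_pow_ne_tau3 : ∀ (i : Fin 6) (r : Fin 5), sylow5 i ^ (r : ℕ) ≠ tau3 := by decide

/-- `(0 1 2) ∈ ⟨σᵢ, σⱼ⟩` for `i ≠ j`. [folklore] -/
theorem tau3_mem_closure_pair {i j : Fin 6} (h : i ≠ j) :
    tau3 ∈ Subgroup.closure ({sylow5 i, sylow5 j} : Set (Perm (Fin 5))) := by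
  rw [← wordProd_pairWord i j h]
  exact wordProd_mem_closure _ _ _

/-- `(0 1 2) ∉ ⟨σᵢ⟩` (a group of order `5`). [folklore] -/
theorem tau3_not_mem_closure_singleton (i : Fin 6) :
    tau3 ∉ Subgroup.closure ({sylow5 i} : Set (Perm (Fin 5))) := by
  rw [Subgroup.mem_closure_singleton]
  rintro ⟨n, hn⟩
  rw [zpow_eq_zpow_emod' n (sylow5_pow_five i)] at hn
  have h0 : 0 ≤ n % ((5 : ℕ) : ℤ) := Int.emod_nonneg _ (by norm_num)
  have h5 : n % ((5 : ℕ) : ℤ) < 5 := Int.emod_lt_of_pos _ (by norm_num)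
  obtain ⟨r, hr⟩ : ∃ r : ℕ, (r : ℤ) = n % ((5 : ℕ) : ℤ) := ⟨_, Int.toNat_of_nonneg h0⟩
  rw [← hr, zpow_natCast] at hn
  have hr5 : r < 5 := by omega
  exact sylow5_pow_ne_tau3 i ⟨r, hr5⟩ hn

/-- **`Th₂⁶` is ONE PERM gate on `5` points** (so is LIN-UNSAT over `ℤ/P` in one unknown with the six
equations `y = 0, …, y = 5`, for EVERY prime `P ≥ 7` — a "mod-`P` behaviour" that no homomorphic image
of `ℤ/P` inside `Sym(5)` could produce, cf. §3): wire `i` switches on a 5-cycle `σᵢ` of the `i`-th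
Sylow 5-subgroup of `A₅`, target `τ = (0 1 2)`; one Sylow subgroup has order `5 ∌ τ`, two distinct
ones generate `A₅ ∋ τ`. The order obstruction `no_zmod_primePow_embedding` is therefore NOT a one-gate
lower bound: PERM gates compute through PAIRWISE GENERATION, and pairwise-generating families in `Sym(d)`
have size exponential in `d` (Blackburn 2006: `2^{d-1}` for large odd... cliques of the generating graph),
so `Th₂ⁿ ∈ PERM_{O(log n)}`. [folklore] -/
theorem thr_six_two_isPermGate : IsPermGate 5 (GateFn.thr 6 2) := by
  refine ⟨5, le_rfl, sylow5, tau3, fun v => ?_⟩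
  show decide (2 ≤ GateFn.numOnes v) = true ↔ _
  rw [decide_eq_true_iff]
  constructor
  · intro h2
    obtain ⟨i, hi, j, hj, hij⟩ := Finset.one_lt_card.1 (show 1 < GateFn.numOnes v from h2)
    simp only [Finset.mem_filter, Finset.mem_univ, true_and] at hi hj
    refine Subgroup.closure_mono ?_ (tau3_mem_closure_pair hij)
    intro x hx
    simp only [Set.mem_insert_iff, Set.mem_singleton_iff] at hx
    rcases hx with rfl | rfl
    · exact ⟨i, hi, rfl⟩
    · exact ⟨j, hj, rfl⟩
  · intro hmem
    by_contra h2
    -- at most one wire is on: the on-set lies inside a singleton `{i₀}`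
    obtain ⟨i₀, hi₀⟩ : ∃ i₀ : Fin 6, {i : Fin 6 | v i = true} ⊆ {i₀} := by
      by_cases hex : ∃ i, v i = true
      · obtain ⟨i, hi⟩ := hex
        refine ⟨i, fun j hj => ?_⟩
        by_contra hji
        refine h2 (Finset.one_lt_card.2 ⟨j, ?_, i, ?_, hji⟩)
        · simpa [GateFn.numOnes] using hj
        · simpa [GateFn.numOnes] using hi
      · refine ⟨0, fun j hj => absurd ⟨j, hj⟩ hex⟩
    have hsub : sylow5 '' {i : Fin 6 | v i = true} ⊆ {sylow5 i₀} := by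
      rintro _ ⟨j, hj, rfl⟩
      rw [Set.mem_singleton_iff, Set.mem_singleton_iff.1 (hi₀ hj)]
    exact tau3_not_mem_closure_singleton i₀ (Subgroup.closure_mono hsub hmem)

end PermThreshold

/-! ### §14.1 Block normal form: one PERM gate with several generators per wire = a size-one circuit -/

section BlockPerm

open Equiv

/-- **Block PERM gates**: wire `i` switches on a whole subgroup `P i ≤ Sym(d)` (equivalently: several
generators), target `τ`; the gate fires iff `τ ∈ ⨆_{vᵢ = 1} P i` — a JOIN condition in the subgroup
lattice. This is the semilattice normal form of the PERM door: `v ↦ ⨆_{vᵢ=1} P i` is a join-homomorphism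
`(2^{[n]}, ∪) → Sub(Sym d)` and the gate is the principal filter `{H | τ ∈ H}` after it. [folklore] -/
def IsBlockPermGate (s : ℕ) (g : GateFn) : Prop :=
  ∃ d : ℕ, d ≤ s ∧ ∃ (P : Fin g.1 → Subgroup (Perm (Fin d))) (τ : Perm (Fin d)),
    ∀ v : Fin g.1 → Bool, g.2 v = true ↔ τ ∈ ⨆ i ∈ {i | v i = true}, P i

/-- The subgroup generated by an indexed image is the join of the cyclic pieces. [folklore] -/
theorem closure_image_eq_iSup {α G : Type*} [Group G] (σ : α → G) (S : Set α) :
    Subgroup.closure (σ '' S) = ⨆ i ∈ S, Subgroup.closure ({σ i} : Set G) := by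
  apply le_antisymm
  · rw [Subgroup.closure_le]
    rintro _ ⟨i, hi, rfl⟩
    exact Subgroup.mem_iSup_of_mem i
      (Subgroup.mem_iSup_of_mem hi (Subgroup.subset_closure (Set.mem_singleton _)))
  · refine iSup₂_le fun i hi => (Subgroup.closure_le _).2 ?_
    rintro _ ⟨⟩
    exact Subgroup.subset_closure ⟨i, hi, rfl⟩

/-- Every PERM gate is a block PERM gate (cyclic blocks). [folklore] -/
theorem IsPermGate.isBlockPermGate {s : ℕ} {g : GateFn} (h : IsPermGate s g) :
    IsBlockPermGate s g := by
  obtain ⟨d, hd, σ, τ, hiff⟩ := h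
  refine ⟨d, hd, fun i => Subgroup.closure {σ i}, τ, fun v => ?_⟩
  rw [hiff, closure_image_eq_iSup]

/-- The join over the switched-on blocks is generated by the switched-on block ELEMENTS. [folklore] -/
theorem iSup_eq_closure_iUnion {n d : ℕ} (P : Fin n → Subgroup (Perm (Fin d))) (v : Fin n → Bool) :
    (⨆ i ∈ {i | v i = true}, P i) =
      Subgroup.closure (⋃ i ∈ {i : Fin n | v i = true}, (P i : Set (Perm (Fin d)))) := by
  rw [Subgroup.closure_iUnion]
  refine iSup_congr fun i => ?_
  rw [Subgroup.closure_iUnion]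
  refine iSup_congr fun _ => ?_
  rw [Subgroup.closure_eq]

/-- **Blocks cost nothing at the circuit level**: a block PERM gate of width `s` is computed by a
size-ONE circuit whose single gate is an honest `PERM_s` gate reading each input wire repeatedly (one
position per element of the block). So provers may design PERM gadgets with arbitrarily many generators
per wire (e.g. the annihilator blocks of an abelian coset constraint, Stub 3a of the line
`csp-spine-meet-to-join`) and still land ONE gate. [folklore] -/
theorem IsBlockPermGate.exists_size_one {s : ℕ} {g : GateFn} (h : IsBlockPermGate s g) :
    ∃ C : Circuit (Fin g.1), C.IsOver {g' | IsPermGate s g'} ∧ C.size ≤ 1 ∧ C.Computes g.2 := by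
  classical
  obtain ⟨d, hd, P, τ, hiff⟩ := h
  -- positions: pairs (wire, element of its block)
  let Pos := Σ i : Fin g.1, P i
  let e : Pos ≃ Fin (Fintype.card Pos) := Fintype.equivFin Pos
  let σ' : Fin (Fintype.card Pos) → Perm (Fin d) := fun a => ((e.symm a).2 : Perm (Fin d))
  let w : Fin (Fintype.card Pos) → Fin g.1 := fun a => (e.symm a).1
  let g' : GateFn := ⟨Fintype.card Pos, fun u => decide (τ ∈ Subgroup.closure (σ' '' {a | u a = true}))⟩
  have hg' : IsPermGate s g' := ⟨d, hd, σ', τ, fun u => by simp [g']⟩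
  obtain ⟨C, hB, hs, hev⟩ := (CktSize.gate (B := {g' | IsPermGate s g'}) g' hg' w).toCircuit
  refine ⟨C, hB, hs, fun x => ?_⟩
  rw [hev x]
  show decide (τ ∈ Subgroup.closure (σ' '' {a | x (w a) = true})) = g.2 x
  have key : Subgroup.closure (σ' '' {a | x (w a) = true}) = ⨆ i ∈ {i | x i = true}, P i := by
    rw [iSup_eq_closure_iUnion]
    congr 1
    ext p
    simp only [Set.mem_image, Set.mem_setOf_eq, Set.mem_iUnion, SetLike.mem_coe, exists_prop]
    constructor
    · rintro ⟨a, ha, rfl⟩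
      exact ⟨w a, ha, (e.symm a).2.2⟩
    · rintro ⟨i, hi, hp⟩
      refine ⟨e ⟨i, ⟨p, hp⟩⟩, ?_, ?_⟩
      · show x (e.symm (e ⟨i, ⟨p, hp⟩⟩)).1 = true
        rw [Equiv.symm_apply_apply]; exact hi
      · show ((e.symm (e ⟨i, ⟨p, hp⟩⟩)).2 : Perm (Fin d)) = p
        rw [Equiv.symm_apply_apply]
  rw [key]
  cases hx : g.2 x
  · rw [decide_eq_false_iff_not]
    intro hmem
    rw [← hiff] at hmem
    rw [hmem] at hx
    exact Bool.noConfusion hx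
  · rw [decide_eq_true_iff]
    exact (hiff x).1 hx

/-- In particular a block PERM gate of width `s` is a size-one circuit over `B_s`. [folklore] -/
theorem IsBlockPermGate.exists_size_one_extGate {s : ℕ} {g : GateFn} (h : IsBlockPermGate s g) :
    ∃ C : Circuit (Fin g.1), C.IsOver (extGate s) ∧ C.size ≤ 1 ∧ C.Computes g.2 := by
  obtain ⟨C, hB, hs, hC⟩ := h.exists_size_one
  exact ⟨C, hB.mono fun g' hg' => IsPermGate.mem_extGate hg', hs, hC⟩

/-! ### §14.3 The Myhill–Nerode chain invariant of (block) PERM gates -/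

/-- The indicator vector of a finset of wires. [folklore] -/
def indVec {n : ℕ} (A : Finset (Fin n)) : Fin n → Bool := fun j => decide (j ∈ A)

/-- The join over a union of selections is the join of the joins. [folklore] -/
theorem iSup_indVec_union {n d : ℕ} (P : Fin n → Subgroup (Perm (Fin d))) (A B : Finset (Fin n)) :
    (⨆ i ∈ {i | indVec (A ∪ B) i = true}, P i) =
      (⨆ i ∈ {i | indVec A i = true}, P i) ⊔ ⨆ i ∈ {i | indVec B i = true}, P i := by
  have hset : {i | indVec (A ∪ B) i = true} = {i | indVec A i = true} ∪ {i | indVec B i = true} := by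
    ext i; simp [indVec]
  rw [hset, _root_.iSup_union]

/-- **Chain invariant (Myhill–Nerode for PERM).** If a block PERM gate of width `s` has nested
selections `S₀ ⊆ S₁ ⊆ ⋯ ⊆ S_L` such that each consecutive pair is DISTINGUISHABLE by some common
extension `T` (the residual functions `T ↦ g(Sᵢ ∪ T)` differ), then the joins `⨆_{Sᵢ} P` form a strict
chain of subgroups of `Sym(d)`, each step at least doubling the order (Lagrange): `2^L ≤ s!`, i.e.
`L ≤ log₂ s! < s log₂ s`. This is the general one-gate lower-bound tool behind `perm_local` (`GateLocality.perm_local`: a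
minterm is such a chain with `T = ∅`-type witnesses). What it yields for the third door: the residual
classes of LIN-UNSAT over `ℤ/2^k` in `D` unknowns are solution submodules, whose chains have length
`≤ k(D+1)` — so the invariant can never force `d` beyond `poly(k, D)`: a super-polynomial ONE-gate lower
bound for the door (if true at all) needs a lattice-embedding obstruction finer than chain length (e.g.
a coordinatisation argument for the submodule lattice of `(ℤ/2^k)^3` inside `Sub(Sym d)`), which is not
in print. [folklore] -/
theorem IsBlockPermGate.two_pow_chain_le {s : ℕ} {g : GateFn} (h : IsBlockPermGate s g) {L : ℕ}
    (S : Fin (L + 1) → Finset (Fin g.1)) (hmono : ∀ i : Fin L, S i.castSucc ⊆ S i.succ)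
    (hdist : ∀ i : Fin L, ∃ T : Finset (Fin g.1),
      g.2 (indVec (S i.castSucc ∪ T)) ≠ g.2 (indVec (S i.succ ∪ T))) :
    2 ^ L ≤ s.factorial := by
  classical
  obtain ⟨d, hd, P, τ, hiff⟩ := h
  let H : Fin (L + 1) → Subgroup (Perm (Fin d)) := fun i => ⨆ j ∈ {j | indVec (S i) j = true}, P j
  have hHmono : ∀ i : Fin L, H i.castSucc ≤ H i.succ := fun i => by
    refine iSup₂_le fun j hj => ?_
    have hj' : j ∈ {j | indVec (S i.succ) j = true} := by
      simp only [Set.mem_setOf_eq, indVec, decide_eq_true_eq] at hj ⊢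
      exact hmono i hj
    exact le_iSup₂_of_le j hj' le_rfl
  have hHne : ∀ i : Fin L, H i.castSucc ≠ H i.succ := fun i heq => by
    obtain ⟨T, hT⟩ := hdist i
    apply hT
    have h1 : (⨆ j ∈ {j | indVec (S i.castSucc ∪ T) j = true}, P j) =
        ⨆ j ∈ {j | indVec (S i.succ ∪ T) j = true}, P j := by
      rw [iSup_indVec_union, iSup_indVec_union]
      exact congrArg (· ⊔ _) heq
    rw [Bool.eq_iff_iff, hiff, hiff, h1]
  -- each strict step at least doubles the order
  have hstep : ∀ i : Fin L, 2 * Nat.card (H i.castSucc) ≤ Nat.card (H i.succ) := fun i => by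
    obtain ⟨q, hq⟩ := Subgroup.card_dvd_of_le (hHmono i)
    have hq2 : 2 ≤ q := by
      rcases Nat.lt_or_ge q 2 with hlt | hge
      · interval_cases q
        · rw [mul_zero] at hq; exact absurd hq (Nat.card_pos (α := H i.succ)).ne'
        · rw [mul_one] at hq
          exact absurd (Subgroup.eq_of_le_of_card_ge (hHmono i) hq.le) (hHne i)
      · exact hge
    calc 2 * Nat.card (H i.castSucc) = Nat.card (H i.castSucc) * 2 := mul_comm _ _
      _ ≤ Nat.card (H i.castSucc) * q := Nat.mul_le_mul_left _ hq2
      _ = Nat.card (H i.succ) := hq.symm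
  have hind : ∀ m : ℕ, (hm : m ≤ L) → 2 ^ m ≤ Nat.card (H ⟨m, Nat.lt_succ_of_le hm⟩) := by
    intro m
    induction m with
    | zero => intro _; rw [pow_zero]; exact Nat.card_pos
    | succ m ih =>
      intro hm
      have := hstep ⟨m, hm⟩
      have ih' := ih (Nat.le_of_succ_le hm)
      simp only [Fin.castSucc_mk, Fin.succ_mk] at this
      calc 2 ^ (m + 1) = 2 * 2 ^ m := by ring
        _ ≤ 2 * Nat.card (H ⟨m, _⟩) := Nat.mul_le_mul_left 2 ih'
        _ ≤ Nat.card (H ⟨m + 1, _⟩) := this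
  calc 2 ^ L ≤ Nat.card (H ⟨L, Nat.lt_succ_self L⟩) := hind L le_rfl
    _ ≤ Nat.card (Perm (Fin d)) := Subgroup.card_le_card_group _
    _ = d.factorial := by rw [Nat.card_eq_fintype_card, Fintype.card_perm, Fintype.card_fin]
    _ ≤ s.factorial := Nat.factorial_le hd

end BlockPerm

end Summit.PneNP.PneNP.Theorems.Capture.Negative
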